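import Literature.Geometry.Symplectic.TaubesFamilyGaugeUniqueness
import HarnessLib

/-!
# The linearised Seiberg–Witten equations at Taubes's solution: the component equations

Topic `Literature/Geometry/Symplectic`.  For the canonical `Spin^c` structure `𝔰_J` of a closed
symplectic `4`-manifold `(N, s, J)` and Taubes's solution `(A₀, ψ₀ = c·u₀)`, `r = |c|²`, of the
Seiberg–Witten equations with perturbation `P₊F_{A₀} - (r/4)s` (`TaubesCanonicalSolution`,
`TaubesFamilyGaugeUniqueness`), the linearisation `DF_{(A₀,ψ₀)}(a, φ)` (Morgan 1996, Lemma 4.2.1;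
the tree's `swLinearization`) of the Seiberg–Witten map in the direction of a real 1-form `a` and a
positive spinor field `φ = α'u₀ + β'` reads, chartwise (Taubes 1994, §3: the linearised form of his
(8), "the same arguments (but linearized) will show that `(A₀, u₀)` is a nondegenerate solution"):

* `(da)⁺₀ = da(e₀,e₁) + da(e₂,e₃) = Re(c̄α')` and `i(da)⁺₁ - (da)⁺₂ = c̄β'`
  (`swLinearization_kaehler_eq`, `swLinearization_zeroTwo_eq` — the entries of `iρ⁺(da) = Dq_{ψ₀}(φ)`
  for `ψ₀⁺ = (0, c)`);
* `D_{A₀}φ = -(i c/2) γ(a)u₀` (`swLinearization_dirac_eq`), hence, by `D_{A₀}(α'u₀) = γ_ℂ(dα')u₀`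
  (`D_{A₀}u₀ = 0`), `D_{A₀}β' = -(ic/2)γ(a)u₀ - γ_ℂ(dα')u₀` (`dirac_betaField_linConfiguration`).

We also record the pointwise algebra of the "algebra side" of the linearised mass identity: with
`α' = c·g`, `g` real (the gauge normalisation `Im(c̄α') = 0`),
`Re⟨D_{A₀}β', D_{A₀}φ⟩ = (r/4)|a|² - (r/2)((dg ∧ a)(e₀,e₁) + (dg ∧ a)(e₂,e₃))`
(`re_star_dirac_betaField_dotProduct_dirac_eq`).  The configuration `(A₀, φ)` is packaged as
`linConfiguration φ` so that the splitting `φ = α'u₀ + β'` of `TaubesFamilyBetaField` applies (with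
`a = ½(A₀ - A₀) = 0`).

## References
* C. H. Taubes, Math. Res. Lett. 1 (1994) 809–822, §2 (6)–(8), §3.
* J. W. Morgan, *The Seiberg–Witten equations…*, Princeton Math. Notes 44 (1996), Lemma 4.2.1, §4.6, §7.1.
* M. Hutchings, C. H. Taubes, in IAS/Park City Math. Ser. 7 (1999), §4.3–4.5.
-/

open scoped Manifold ContDiff Topology ComplexConjugate Matrix
open Set Function Filter Complex Literature.Geometry.Kaehler Literature.Geometry.GaugeTheory Literature.Topology.FourManifolds
open Literature.Geometry.Lorentzian (PseudoRiemannianMetric)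
open Literature.Geometry.Manifold Literature.Geometry.Manifold.DeRhamSignFour Literature.NumberTheory.Transcendental

section

/-! ### Entries of `Dq_{(0,c)}` -/

namespace Literature.Geometry.GaugeTheory

/-- `(Dq_{(0,c)}(η))₁₁ = (c̄η₁ + c η̄₁)/2 = Re(c̄η₁)`. [cite: MorganSWBook1996, Lemma 4.2.1] -/
theorem spinorQuadDeriv_zero_apply_one_one (c : ℂ) (η : Fin 2 → ℂ) :
    spinorQuadDeriv ![0, c] η 1 1 = (conj c * η 1 + c * conj (η 1)) / 2 := by
  simp [spinorQuadDeriv, Matrix.vecMulVec_apply, dotProduct, Fin.sum_univ_two, Matrix.sub_apply, Matrix.add_apply,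
    Matrix.smul_apply]
  ring

/-- `(Dq_{(0,c)}(η))₀₁ = c̄η₀`. [cite: MorganSWBook1996, Lemma 4.2.1] -/
theorem spinorQuadDeriv_zero_apply_zero_one (c : ℂ) (η : Fin 2 → ℂ) :
    spinorQuadDeriv ![0, c] η 0 1 = conj c * η 0 := by
  simp [spinorQuadDeriv, Matrix.vecMulVec_apply, dotProduct, Fin.sum_univ_two, Matrix.sub_apply, Matrix.add_apply,
    Matrix.smul_apply, mul_comm]

/-- `γ(a) = γ_ℂ(a)` for a real 1-form read as a complex one (definitional). [cite: MorganSWBook1996, §3.3 (3.1)] -/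
theorem SpincStructure.cliffordOneForm_eq_cliffordComplexOneForm {X : Type*} [TopologicalSpace X]
    [ChartedSpace (EuclideanSpace ℝ (Fin 4)) X] (a : RealOneForm X) (x : X) (e : Fin 4 → TangentSpace (𝓡 4) x) :
    SpincStructure.cliffordOneForm a x e = cliffordComplexOneForm (fun y w ↦ ((a y w : ℝ) : ℂ)) x e := rfl

end Literature.Geometry.GaugeTheory

namespace Literature.Geometry.Symplectic

open Literature.Geometry.GaugeTheory.SpincStructure

namespace AlmostComplexStructure.IsCompatibleWith

variable {N : Type} [TopologicalSpace N] [ChartedSpace (EuclideanSpace ℝ (Fin 4)) N] [IsManifold (𝓡 4) ∞ N]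
  {J : AlmostComplexStructure (𝓡 4) ∞ N} {s : MForm (𝓡 4) N ℝ 2}
  (h : J.IsCompatibleWith s) (hs : IsSmoothForm s)
  (hnd : ∀ x (v : TangentSpace (𝓡 4) x), v ≠ 0 → ∃ w : TangentSpace (𝓡 4) x, s x ![v, w] ≠ 0)

variable [(h.metric hs).HasLeviCivita]

/-! ### The configuration `(A₀, φ)` -/

/-- **The configuration `(A₀, φ)`** of a positive smooth spinor field `φ` with Taubes's connection:
the tangent vector `(a, φ)` at `(A₀, ψ₀)` read as a configuration, so that `φ = α'u₀ + β'`
(`alphaFun`, `betaField`) and `a(A₀, A₀) = 0`. [cite: Taubes1994, §3] -/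
noncomputable def linConfiguration (φ : SpinorField (h.canonicalSpincStructure hs hnd)) (hφ : φ.IsPlus) (hφ' : φ.IsSmooth) :
    (h.canonicalSpincStructure hs hnd).Configuration :=
  ⟨h.taubesConnection hs hnd, φ, hφ, hφ'⟩

/-- The connection of `(A₀, φ)` (definitional). [cite: Taubes1994, §3] -/
@[simp] theorem linConfiguration_conn (φ : SpinorField (h.canonicalSpincStructure hs hnd)) (hφ : φ.IsPlus) (hφ' : φ.IsSmooth) :
    (h.linConfiguration hs hnd φ hφ hφ').conn = h.taubesConnection hs hnd := rfl

/-- The spinor of `(A₀, φ)` (definitional). [cite: Taubes1994, §3] -/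
@[simp] theorem linConfiguration_spinor (φ : SpinorField (h.canonicalSpincStructure hs hnd)) (hφ : φ.IsPlus) (hφ' : φ.IsSmooth) :
    (h.linConfiguration hs hnd φ hφ hφ').spinor = φ := rfl

/-- `a(A₀, A₀) = ½(A₀ - A₀) = 0`. [cite: HutchingsTaubes2006, §4.3] -/
theorem halfConnectionDiff_linConfiguration (φ : SpinorField (h.canonicalSpincStructure hs hnd)) (hφ : φ.IsPlus)
    (hφ' : φ.IsSmooth) : h.halfConnectionDiff hs hnd (h.linConfiguration hs hnd φ hφ hφ') = 0 := by
  funext x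
  simp [halfConnectionDiff, SpincStructure.connectionDiff]

/-- With `a = 0`, `∇'α = dα`. [cite: HutchingsTaubes2006, §4.3] -/
theorem connDeriv_alphaFun_linConfiguration (φ : SpinorField (h.canonicalSpincStructure hs hnd)) (hφ : φ.IsPlus)
    (hφ' : φ.IsSmooth) (x : N) (v : TangentSpace (𝓡 4) x) :
    connDeriv (h.alphaFun hs hnd (h.linConfiguration hs hnd φ hφ hφ')) (h.halfConnectionDiff hs hnd (h.linConfiguration hs hnd φ hφ hφ')) x v =
      complexDeriv (h.alphaFun hs hnd (h.linConfiguration hs hnd φ hφ hφ')) x v := by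
  simp [connDeriv, halfConnectionDiff_linConfiguration]

/-! ### The linearised equations in components -/

/-- **The Kähler component of the linearised curvature equation**: `(da)⁺₀ = Re(c̄ α')` where
`α' = φ_{u₀}` — the `(1,1)` entry of `iρ⁺(da) = Dq_{ψ₀}(φ)`, `ψ₀⁺ = (0, c)` (the linearisation of
Taubes's `(∗iF_a ∧ ω)/2 + 1 = |α|² - |β|²`). [cite: Taubes1994, §2 (8), §3] [cite: MorganSWBook1996, Lemma 4.2.1, §7.1 (7.1)] -/
theorem swLinearization_kaehler_eq (c : ℂ) (a : RealOneForm N) (φ : SpinorField (h.canonicalSpincStructure hs hnd))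
    {i x : N} (hK : (h.canonicalSpincStructure hs hnd).swLinearization
      (h.canonicalConfiguration hs hnd (h.taubesConnection hs hnd) c) a φ i x = 0) :
    ((sdCoeff ((h.canonicalSpincStructure hs hnd).extDerivMatrix a i x) 0 : ℝ) : ℂ) =
      (conj c * φ.toFun i x (Sum.inl 1) + c * conj (φ.toFun i x (Sum.inl 1))) / 2 := by
  have h1 := congrArg (fun M : Matrix (Fin 2) (Fin 2) ℂ ↦ M 1 1) (congrArg Prod.fst hK)
  simp only [SpincStructure.swLinearization, plusSpinor_canonicalConfiguration, Matrix.sub_apply, Prod.fst_zero,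
    Matrix.zero_apply, I_smul_plusAction_apply_one_one, spinorQuadDeriv_zero_apply_one_one] at h1
  linear_combination h1

/-- **The `(0,2)` component of the linearised curvature equation**: `i(da)⁺₁ - (da)⁺₂ = c̄ β'` where
`β' = φ_{u₁}` — the `(0,1)` entry of `iρ⁺(da) = Dq_{ψ₀}(φ)` (the linearisation of Taubes's
`P₋F_a = ᾱβ/2`). [cite: Taubes1994, §2 (8), §3] [cite: MorganSWBook1996, Lemma 4.2.1, §7.1 (7.2)] -/
theorem swLinearization_zeroTwo_eq (c : ℂ) (a : RealOneForm N) (φ : SpinorField (h.canonicalSpincStructure hs hnd))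
    {i x : N} (hK : (h.canonicalSpincStructure hs hnd).swLinearization
      (h.canonicalConfiguration hs hnd (h.taubesConnection hs hnd) c) a φ i x = 0) :
    I * ((sdCoeff ((h.canonicalSpincStructure hs hnd).extDerivMatrix a i x) 1 : ℝ) : ℂ) -
        ((sdCoeff ((h.canonicalSpincStructure hs hnd).extDerivMatrix a i x) 2 : ℝ) : ℂ) =
      conj c * φ.toFun i x (Sum.inl 0) := by
  have h1 := congrArg (fun M : Matrix (Fin 2) (Fin 2) ℂ ↦ M 0 1) (congrArg Prod.fst hK)
  simp only [SpincStructure.swLinearization, plusSpinor_canonicalConfiguration, Matrix.sub_apply, Prod.fst_zero,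
    Matrix.zero_apply, I_smul_plusAction_apply_zero_one, spinorQuadDeriv_zero_apply_zero_one] at h1
  linear_combination h1

/-- **The linearised Dirac equation**: `D_{A₀}φ = -(ic/2) γ(a)u₀` (`D_{A₀}φ + ½ iγ(a)ψ₀ = 0`, `ψ₀ = c u₀`).
[cite: Taubes1994, §2 (8), §3] [cite: MorganSWBook1996, Lemma 4.2.1] -/
theorem swLinearization_dirac_eq (c : ℂ) (a : RealOneForm N) (φ : SpinorField (h.canonicalSpincStructure hs hnd))
    {i x : N} (hK : (h.canonicalSpincStructure hs hnd).swLinearization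
      (h.canonicalConfiguration hs hnd (h.taubesConnection hs hnd) c) a φ i x = 0) :
    dirac (h.taubesConnection hs hnd) φ i x =
      -(((2 : ℂ)⁻¹ * I * c) • (cliffordOneForm a x (fun k ↦ (h.canonicalSpincStructure hs hnd).frame i k x) *ᵥ plusUnit)) := by
  have h2 := congrArg Prod.snd hK
  simp only [SpincStructure.swLinearization, canonicalConfiguration_conn, canonicalConfiguration_spinor_toFun,
    Matrix.mulVec_smul, smul_smul, Prod.snd_zero] at h2
  exact eq_neg_of_add_eq_zero_left h2

/-- **`D_{A₀}β' = D_{A₀}φ - γ_ℂ(dα')u₀`** for `φ = α'u₀ + β'` (`D_{A₀}(α'u₀) = γ_ℂ(dα')u₀` as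
`D_{A₀}u₀ = 0`, `ds = 0`). [cite: HutchingsTaubes2006, §4.3 (4.8)–(4.10)] [cite: Taubes1995, §5 (5.4)] -/
theorem dirac_betaField_linConfiguration (hcl : IsClosedForm s) (φ : SpinorField (h.canonicalSpincStructure hs hnd))
    (hφ : φ.IsPlus) (hφ' : φ.IsSmooth) (i : N) {x : N} (hx : x ∈ (h.canonicalSpincStructure hs hnd).baseSet i) :
    dirac (h.taubesConnection hs hnd) (h.betaField hs hnd (h.linConfiguration hs hnd φ hφ hφ')) i x =
      dirac (h.taubesConnection hs hnd) φ i x -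
        cliffordComplexOneForm (fun y w ↦ complexDeriv (h.alphaFun hs hnd (h.linConfiguration hs hnd φ hφ hφ')) y w) x
          (fun k ↦ (h.canonicalSpincStructure hs hnd).frame i k x) *ᵥ plusUnit := by
  have hα := ((h.contMDiff_alphaFun hs hnd (h.linConfiguration hs hnd φ hφ hφ')) x).mdifferentiableAt (by simp)
  have hdec := h.spinor_eq_smul_canonicalSpinor_add_betaField hs hnd (h.linConfiguration hs hnd φ hφ hφ')
  rw [linConfiguration_spinor] at hdec
  have hsum : dirac (h.taubesConnection hs hnd) φ i x =
      dirac (h.taubesConnection hs hnd) (h.alphaFun hs hnd (h.linConfiguration hs hnd φ hφ hφ') • h.canonicalSpinor hs hnd) i x +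
        dirac (h.taubesConnection hs hnd) (h.betaField hs hnd (h.linConfiguration hs hnd φ hφ hφ')) i x := by
    conv_lhs => rw [hdec]
    exact dirac_add _ (h.spinorMDiffAt_smul_canonicalSpinor hs hnd hα i)
      ((h.isSmooth_betaField hs hnd (h.linConfiguration hs hnd φ hφ hφ')).spinorMDiffAt hx)
  have hαu := h.dirac_smul_canonicalSpinor_eq hs hnd hcl (h.linConfiguration hs hnd φ hφ hφ') i hx
  rw [linConfiguration_conn] at hαu
  simp only [connDeriv_alphaFun_linConfiguration] at hαu
  rw [hsum, hαu]
  abel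

/-! ### The algebra side of the mass identity, pointwise -/

omit [IsManifold (𝓡 4) ∞ N] in
/-- For a real-valued function `g` and `α' = c·g`: `dα'(v) = c·dg(v)`. [folklore] -/
theorem complexDeriv_const_mul_ofReal {g : N → ℝ} {x : N} (hg : MDifferentiableAt (𝓡 4) 𝓘(ℝ, ℝ) g x) (c : ℂ)
    (v : TangentSpace (𝓡 4) x) :
    complexDeriv (fun y ↦ c * ((g y : ℝ) : ℂ)) x v = c * ((RealOneForm.ofFun g x v : ℝ) : ℂ) := by
  have hgc : MDifferentiableAt (𝓡 4) 𝓘(ℝ, ℂ) (fun y ↦ ((g y : ℝ) : ℂ)) x :=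
    ((Complex.ofRealCLM : ℝ →L[ℝ] ℂ).hasMFDerivAt.comp x hg.hasMFDerivAt).mdifferentiableAt
  rw [complexDeriv_const_mul c hgc, complexDeriv_ofReal_comp hg]

/-- **The algebra side of the linearised mass identity, pointwise.** If `D_{A₀}φ = -(ic/2)γ(a)u₀` and
`α' = c·g` with `g` real, then, with `a_k = a(e_k)`, `g_k = dg(e_k)` and `r = |c|²`,
`Re⟨D_{A₀}β', D_{A₀}φ⟩ = (r/4)Σ_k a_k² - (r/2)((g₀a₁ - g₁a₀) + (g₂a₃ - g₃a₂))`
(`D_{A₀}β' = -γ_ℂ(c dg + (ic/2)a)u₀`, `γ_ℂ(θ)u₀ = (0; θ₂+iθ₃, -(θ₀+iθ₁))`).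
[cite: Taubes1994, §3 (the linearised (18)–(21))] [cite: HutchingsTaubes2006, §4.5] -/
theorem re_star_dirac_betaField_dotProduct_dirac_eq (hcl : IsClosedForm s) (c : ℂ)
    (a : RealOneForm N) (φ : SpinorField (h.canonicalSpincStructure hs hnd)) (hφ : φ.IsPlus) (hφ' : φ.IsSmooth)
    {g : N → ℝ} (hg : ContMDiff (𝓡 4) 𝓘(ℝ, ℝ) ∞ g)
    (hαg : ∀ y, h.alphaFun hs hnd (h.linConfiguration hs hnd φ hφ hφ') y = c * ((g y : ℝ) : ℂ))
    (i : N) {x : N} (hx : x ∈ (h.canonicalSpincStructure hs hnd).baseSet i)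
    (hD : dirac (h.taubesConnection hs hnd) φ i x =
      -(((2 : ℂ)⁻¹ * I * c) • (cliffordOneForm a x (fun k ↦ (h.canonicalSpincStructure hs hnd).frame i k x) *ᵥ plusUnit))) :
    (star (dirac (h.taubesConnection hs hnd) (h.betaField hs hnd (h.linConfiguration hs hnd φ hφ hφ')) i x) ⬝ᵥ
        dirac (h.taubesConnection hs hnd) φ i x).re =
      4⁻¹ * Complex.normSq c * ∑ k, a x ((h.canonicalSpincStructure hs hnd).frame i k x) ^ 2 -
        2⁻¹ * Complex.normSq c *
          ((RealOneForm.ofFun g x ((h.canonicalSpincStructure hs hnd).frame i 0 x) * a x ((h.canonicalSpincStructure hs hnd).frame i 1 x) -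
              RealOneForm.ofFun g x ((h.canonicalSpincStructure hs hnd).frame i 1 x) * a x ((h.canonicalSpincStructure hs hnd).frame i 0 x)) +
            (RealOneForm.ofFun g x ((h.canonicalSpincStructure hs hnd).frame i 2 x) * a x ((h.canonicalSpincStructure hs hnd).frame i 3 x) -
              RealOneForm.ofFun g x ((h.canonicalSpincStructure hs hnd).frame i 3 x) * a x ((h.canonicalSpincStructure hs hnd).frame i 2 x))) := by
  have hgd : ∀ y, MDifferentiableAt (𝓡 4) 𝓘(ℝ, ℝ) g y := fun y ↦ (hg y).mdifferentiableAt (by simp)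
  have hαfun : h.alphaFun hs hnd (h.linConfiguration hs hnd φ hφ hφ') = fun y ↦ c * ((g y : ℝ) : ℂ) := funext hαg
  rw [h.dirac_betaField_linConfiguration hs hnd hcl φ hφ hφ' i hx, hD, hαfun]
  simp only [complexDeriv_const_mul_ofReal (hgd _) c, cliffordOneForm_eq_cliffordComplexOneForm,
    cliffordComplexOneForm_mulVec_plusUnit]
  -- explicit vectors in `S⁻`
  simp only [dotProduct, Fintype.sum_sum_type, Fin.sum_univ_two, Pi.star_apply, Pi.neg_apply, Pi.sub_apply, Pi.smul_apply,
    Sum.elim_inl, Sum.elim_inr, Pi.zero_apply, Matrix.cons_val_zero, Matrix.cons_val_one, smul_eq_mul,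
    star_zero, neg_zero, sub_zero, mul_zero, add_zero, zero_add, Fin.sum_univ_four, Complex.normSq_apply]
  simp only [Complex.star_def, map_neg, map_sub, map_mul, map_add, Complex.conj_ofReal, Complex.conj_I, map_inv₀, map_ofNat]
  simp only [Complex.add_re, Complex.sub_re, Complex.neg_re, Complex.mul_re, Complex.mul_im, Complex.add_im, Complex.sub_im,
    Complex.neg_im, Complex.ofReal_re, Complex.ofReal_im, Complex.I_re, Complex.I_im, Complex.conj_re, Complex.conj_im,
    Complex.inv_re, Complex.inv_im, Complex.normSq_ofNat, Complex.re_ofNat, Complex.im_ofNat]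
  ring

end AlmostComplexStructure.IsCompatibleWith

end Literature.Geometry.Symplectic

end
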